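import Literature.Computability.AlgebraicComplexity.QuantumFunctionalsUpperEqLower
import Literature.Computability.AlgebraicComplexity.QuantumFunctionalsDirectSumSubadditive
import Literature.Computability.AlgebraicComplexity.QuantumFunctionalsDimensionBounds
import Literature.NumberTheory.DiophantineGeometry.KroneckerSemigroup
import Literature.Computability.AlgebraicComplexity.UnitTensorMomentPolytopeProofs
import Literature.Computability.Complexity.OccurrenceObstructionsIP
import HarnessLib

/-!
# The occurring isotypic types of the powers of a tensor form a semigroup (`S(t)` is a semigroup)

Topic `Computability/AlgebraicComplexity`; proofs file (theorems only, no definitions, no named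
facts) written while serving the named fact `vandenBergEtAl2025_unitTensor_four_polytope_maximal`
(`UnitTensorMomentPolytope.lean`, "`Δ(⟨4⟩) = Kron(4,4,4)`" in semigroup form). That fact, the crux
`UnitTensorPolytopeMaximal` of route `MatrixMultiplication/IsotypicSaturation`, and the crux
`PolytopeSaturation` of the same route all speak about the set

  `S(t) = {(n; λ⁽⁰⁾, λ⁽¹⁾, λ⁽²⁾) : isotypicSum₁ λ⁽⁰⁾ (isotypicSum₂ λ⁽¹⁾ (isotypicSum₃ λ⁽²⁾ t^{⊗n})) ≠ 0}`

of partition triples OCCURRING in the tensor powers `kroneckerPow t n` of a complex 3-tensor `t`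
(the isotypic character sums of `QuantumFunctionalsUpper.lean`; by Schur–Weyl duality this is
Bürgisser–Ikenmeyer's *semigroup of representations* of the orbit closure `cl(GL³·t)`,
[BurgisserIkenmeyer2011, Def. 3.1], whose normalised closure is the moment polytope `Δ(t)`,
[vandenBergChristandlLysikovNieuwboerWalterZuiddam2025, §1, "second description"]), and about its
saturation "some multiple `kλ` occurs". This file PROVES the two structural facts about `S(t)` that
every such argument uses and that were missing from the tree:

* **`S(t)` is a semigroup** (`isotypicSum₁₂₃_kroneckerPow_ne_zero_rowAdd`; weight form
  `…_of_ofPartition_add'`; alphabets `Fin a` first, `…_of_ofPartition_add`, `…_rowAdd_fin`): if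
  `λ ⊢ n` occurs in `t^{⊗n}` and `λ' ⊢ m` in `t^{⊗m}` then the row-wise sum `λ + λ'`
  (`Nat.Partition.rowAdd`) occurs in `t^{⊗(n+m)}` — BI 2011, Def. 3.1: "It is known that `S(w)` is
  a finitely generated subsemigroup" (finite generation, which needs Hilbert's finiteness theorem
  for `U`-invariants, is NOT treated here);
* **scaling** (`isotypicSum₁₂₃_kroneckerPow_ne_zero_of_parts_eq_map_mul'`,
  `exists_isotypicSum₁₂₃_kroneckerPow_mul_ne_zero`): if `λ` occurs in `t^{⊗n}` then `kλ` (parts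
  multiplied by `k ≥ 1`) occurs in `t^{⊗kn}`; so the conclusion of
  `vandenBergEtAl2025_unitTensor_four_polytope_maximal` for one multiple gives it for all further
  multiples, and normalised occurring triples depend only on rays (BI 2011, Lemma 10.18–10.19:
  rational points of the polytope have multiples in `S(w)`);
* **closure of "some multiple occurs" under row-wise sums** (§8,
  `exists_mul_rowAdd_isotypicSum₁₂₃_kroneckerPow_ne_zero`): the set of triples a multiple of which
  occurs — the shape of the conclusion of `vandenBergEtAl2025_unitTensor_four_polytope_maximal` — is
  closed under `Nat.Partition.rowAdd`; so that conclusion, once known on generators of a semigroup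
  of triples, holds on the whole semigroup (the glue of "hit the generators" arguments, BI 2011
  Lemma 10.18–10.19).

## The printed argument and its formalisation

BI 2011 §10.1 / Christandl–Harrow–Mitchison 2007 / Ikenmeyer–Panova 2017 §1.1 ("the semigroup
property follows from multiplying highest weight vectors"): `λ ∈ S(t)` iff some highest-weight
vector of weight `λ` of the coordinate ring does not vanish on the orbit of `t`; products of
highest-weight vectors are highest-weight vectors of the summed weight, and the orbit is
irreducible. In the coordinates of the tree this becomes (all for alphabets `Fin a, Fin b, Fin c`,
then transported to arbitrary finite index types by relabelling letters, §7):

1. (§1) the triple character sum is a nonzero multiple of `(P_λ ⊗ P_μ ⊗ P_ν)·u` for the isotypic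
   projector matrices `wordIsotypicMatrix` (tree: `upperProjection_eq_smul_actTensor`);
2. (§3, occurrence ⇒ pairing) if `(P ⊗ P ⊗ P) t^{⊗n} ≠ 0` then
   `⟪((A ⊗ B ⊗ C)·t)^{⊗n}, ξ₁ ⊗ ξ₂ ⊗ ξ₃⟫ ≠ 0` for some matrices `A, B, C` and highest-weight vectors
   `ξⱼ` of weights `λ⁽ʲ⁾` in the word models (tree: Schur–Weyl duality in span form,
   `exists_pairing_triad_ne_zero`, `pairing_triad_wordRep` of `QuantumFunctionalsUpperEqLower.lean`);
3. (§2, pairing ⇒ occurrence) conversely such a non-vanishing pairing, for ANY square `A, B, C`,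
   forces occurrence: move the action across the pairing (`sum_mul_actTensor`), note that
   `(Aᵀ)^{⊗n} ξ` stays in the range of the symmetric idempotent `P_λ` (`P_λ` fixes `HW_λ`,
   `isotypicProj_apply_of_mem_highestWeightSpace`, and commutes with `M^{⊗n}`,
   `wordIsotypicMatrix_mul_powMat`);
4. (§4, common translate) the two pairings obtained from `λ ∈ S(t)_n` and `λ' ∈ S(t)_m` live at
   different translates `(A₀,B₀,C₀)`, `(A₁,B₁,C₁)`; along the line joining them each pairing is a
   polynomial in the parameter, nonzero at one point, so both are nonzero at a common point
   (finitely many roots, `ℂ` infinite) — this elementary step replaces the irreducibility of `GL³`;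
5. (§5) at a common translate `x` the pairings multiply:
   `⟪x^{⊗(n+m)}, (ξ₁⊙ξ₁') ⊗ (ξ₂⊙ξ₂') ⊗ (ξ₃⊙ξ₃')⟫ = ⟪x^{⊗n}, Ξ⟫ ⟪x^{⊗m}, Ξ'⟫` for the concatenation
   products `⊙ = concatFun` (tree, `KroneckerSemigroup.lean`), and `ξ ⊙ ξ'` is a highest-weight
   vector of the summed weight (`concatFun_mem_highestWeightSpace`); §2 then gives
   `λ + λ' ∈ S(t)_{n+m}` (§6), and iterating, `kλ ∈ S(t)_{kn}` (weights of scaled partitions: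
   `ofPartition_eq_smul_of_parts_eq`; of row-wise sums: `ofPartition_rowAdd`).

## References

* [BurgisserIkenmeyer2011] P. Bürgisser, C. Ikenmeyer, *Geometric complexity theory and tensor
  rank*, STOC 2011 = arXiv:1011.1350, Def. 3.1 and (3.1), §10.1 (highest weight vectors),
  Lemma 10.18–10.19.
* [IkenmeyerPanova2017] C. Ikenmeyer, G. Panova, Adv. Math. 319 (2017), §1.1 (semigroup property of
  Kronecker coefficients by multiplying highest weight vectors; after Christandl–Harrow–Mitchison,
  Comm. Math. Phys. 270 (2007)).
* [vandenBergChristandlLysikovNieuwboerWalterZuiddam2025] M. van den Berg et al., *The moment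
  polytope of matrix multiplication is not maximal*, arXiv:2503.22633, §1 (representation-theoretic
  description of `Δ(T)`).
* [ChristandlVranaZuiddam2023] M. Christandl, P. Vrana, J. Zuiddam, J. Amer. Math. Soc. 36 (2023),
  §3.1 (the projectors `P_λ`), Lemma 3.6 (proof).
* [FultonHarrisGTM129] W. Fulton, J. Harris, *Representation Theory*, Thm. 6.3.

## Tree

`QuantumFunctionalsUpperEqLower` (pairing, `exists_pairing_triad_ne_zero`, transposes),
`QuantumFunctionalsSpectrumEstimation` (`upperProjection_eq_smul_actTensor`),
`QuantumFunctionalsDirectSumSubadditive` (`wordIsotypicMatrix_mul_powMat`),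
`QuantumFunctionalsDimensionBounds` (`ofPartition_eq_smul_of_parts_eq`), `KroneckerPowMarginals`
(`kroneckerPow_actTensor_powMat`), `UnitTensorMomentPolytopeProofs` (occurrence is monotone under
restriction), `Literature.NumberTheory.DiophantineGeometry.KroneckerSemigroup` (`concatFun`),
`Literature.RepresentationTheory.GeneralLinear.WordModelIsotypicSpan`,
`Literature.Computability.Complexity.OccurrenceObstructionsIP` (`Nat.Partition.rowAdd`,
`ofPartition_rowAdd`). Mathlib: `Polynomial.roots`, `Infinite.exists_notMem_finset`,
`Fin.appendEquiv`, `Finset.sum_mul_sum`.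
-/

noncomputable section

open scoped BigOperators Matrix

namespace Literature.Computability.AlgebraicComplexity

open Literature.NumberTheory.DiophantineGeometry (Word wordRep wordRep_apply wordPermRep
  spechtCharacter highestWeightSpace Weight concatFun concatFun_apply concatFun_append
  concatFun_mem_highestWeightSpace)
open Literature.RepresentationTheory.FiniteGroups (wordIsotypicMatrix wordIsotypicMatrix_apply
  wordIsotypicMatrix_mulVec wordIsotypicProj isotypicProj)
open Literature.RepresentationTheory.GeneralLinear (isotypicProj_apply_of_mem_highestWeightSpace
  highestWeightSpace_ofPartition_eq_bot_of_lt)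

/-! ## §1 The triple isotypic character sum is a nonzero multiple of `P_λ ⊗ P_μ ⊗ P_ν` -/

section Projector

variable {a b c n : ℕ}

/-- On alphabets `Fin a, Fin b, Fin c` the triple isotypic character sum of
`QuantumFunctionalsUpper.lean` is a nonzero multiple of the action of the triple of isotypic
projector matrices: `isotypicSum₁ λ (isotypicSum₂ μ (isotypicSum₃ ν u)) = z • (P_λ ⊗ P_μ ⊗ P_ν)·u`,
`z = (n!)³/(f^λ f^μ f^ν) ≠ 0`. [cite: ChristandlVranaZuiddam2023, §3.1] -/
theorem isotypicSum₁₂₃_eq_smul_actTensor (lam : Fin 3 → Nat.Partition n)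
    (u : Word a n → Word b n → Word c n → ℂ) :
    ∃ z : ℂ, z ≠ 0 ∧ isotypicSum₁ (lam 0) (isotypicSum₂ (lam 1) (isotypicSum₃ (lam 2) u)) =
      z • actTensor (wordIsotypicMatrix a n (lam 0)) (wordIsotypicMatrix b n (lam 1))
        (wordIsotypicMatrix c n (lam 2)) u := by
  obtain ⟨z, hz, h⟩ := upperProjection_eq_smul_actTensor (fun _ => (1 : ℝ)) lam u
  exact ⟨z, hz, by simpa [upperProjection] using h⟩

/-- **Occurrence in projector form**: the triple isotypic character sum does not kill `u` iff
`(P_λ ⊗ P_μ ⊗ P_ν)·u ≠ 0`. [cite: ChristandlVranaZuiddam2023, §3.1] -/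
theorem isotypicSum₁₂₃_ne_zero_iff (lam : Fin 3 → Nat.Partition n)
    (u : Word a n → Word b n → Word c n → ℂ) :
    isotypicSum₁ (lam 0) (isotypicSum₂ (lam 1) (isotypicSum₃ (lam 2) u)) ≠ 0 ↔
      actTensor (wordIsotypicMatrix a n (lam 0)) (wordIsotypicMatrix b n (lam 1))
        (wordIsotypicMatrix c n (lam 2)) u ≠ 0 := by
  obtain ⟨z, hz, h⟩ := isotypicSum₁₂₃_eq_smul_actTensor lam u
  rw [h, smul_ne_zero_iff]
  exact ⟨fun h' => h'.2, fun h' => ⟨hz, h'⟩⟩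

end Projector

/-! ## §2 From a non-vanishing pairing with translated highest-weight vectors to occurrence -/

section FromPairing

variable {a b c n : ℕ}

/-- The bilinear pairing with the action in the FIRST slot:
`⟪(A ⊗ B ⊗ C)·Y, T⟫ = ⟪Y, (Aᵀ ⊗ Bᵀ ⊗ Cᵀ)·T⟫`. [folklore] -/
theorem sum_actTensor_mul {α β γ : Type*} [Fintype α] [Fintype β] [Fintype γ]
    (Y T : α → β → γ → ℂ) (A : Matrix α α ℂ) (B : Matrix β β ℂ) (C : Matrix γ γ ℂ) :
    ∑ u, ∑ v, ∑ w, actTensor A B C Y u v w * T u v w =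
      ∑ u, ∑ v, ∑ w, Y u v w * actTensor Aᵀ Bᵀ Cᵀ T u v w := by
  rw [show (∑ u, ∑ v, ∑ w, actTensor A B C Y u v w * T u v w) =
      ∑ u, ∑ v, ∑ w, T u v w * actTensor A B C Y u v w from
    Finset.sum_congr rfl fun u _ => Finset.sum_congr rfl fun v _ =>
      Finset.sum_congr rfl fun w _ => mul_comm _ _, sum_mul_actTensor]
  exact Finset.sum_congr rfl fun u _ => Finset.sum_congr rfl fun v _ =>
    Finset.sum_congr rfl fun w _ => mul_comm _ _

/-- **`P_λ ξ = ξ` for every highest-weight vector `ξ` of weight `λ`** in the word model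
`(ℂ^N)^{⊗n}` (no hypothesis on the number of parts: when `λ` has more than `N` parts the
highest-weight space is zero). [cite: FultonHarrisGTM129, Thm. 6.3 (2)] -/
theorem wordIsotypicMatrix_mulVec_of_mem_highestWeightSpace {N : ℕ} {lam : Nat.Partition n}
    {ξ : Word N n → ℂ} (hξ : ξ ∈ highestWeightSpace (wordRep ℂ N n) (Weight.ofPartition N lam)) :
    wordIsotypicMatrix N n lam *ᵥ ξ = ξ := by
  rw [wordIsotypicMatrix_mulVec]
  by_cases hN : lam.parts.card ≤ N
  · exact isotypicProj_apply_of_mem_highestWeightSpace lam hN hξ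
  · have hbot := highestWeightSpace_ofPartition_eq_bot_of_lt (n := n) (N := N) (μ := lam)
      (not_le.1 hN)
    rw [hbot, Submodule.mem_bot] at hξ
    simp [hξ]

/-- `P_λ` commutes with `M^{⊗n}` on vectors: the `λ`-isotypic component of `(ℂ^N)^{⊗n}` is stable
under `M^{⊗n}` for every (possibly singular) `N × N` matrix `M`. [cite: ChristandlVranaZuiddam2023, Lemma 3.6 (proof)] -/
theorem wordIsotypicMatrix_mulVec_powMat_mulVec {N : ℕ} (lam : Nat.Partition n)
    (M : Matrix (Fin N) (Fin N) ℂ) (ξ : Word N n → ℂ) :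
    wordIsotypicMatrix N n lam *ᵥ (powMat M n *ᵥ ξ) =
      powMat M n *ᵥ (wordIsotypicMatrix N n lam *ᵥ ξ) := by
  rw [Matrix.mulVec_mulVec, Matrix.mulVec_mulVec, wordIsotypicMatrix_mul_powMat]

/-- **From a pairing to occurrence.** If highest-weight vectors `ξ₁, ξ₂, ξ₃` of weights
`λ⁽⁰⁾, λ⁽¹⁾, λ⁽²⁾` pair non-trivially with a power of some restriction of `t`,
`⟪((A ⊗ B ⊗ C)·t)^{⊗n}, ξ₁ ⊗ ξ₂ ⊗ ξ₃⟫ ≠ 0` (any square matrices `A, B, C`, invertible or not),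
then the triple `λ` occurs in `t^{⊗n}`: `⟪((A⊗B⊗C)t)^{⊗n}, Ξ⟫ = ⟪t^{⊗n}, (Aᵀ⊗Bᵀ⊗Cᵀ)^{⊗n} Ξ⟫`,
the translate `(Aᵀ⊗Bᵀ⊗Cᵀ)^{⊗n} Ξ` is again fixed by `P_λ ⊗ P_μ ⊗ P_ν`, which is symmetric.
[cite: BurgisserIkenmeyer2011, §3.1 and §10.1] -/
theorem isotypicSum₁₂₃_kroneckerPow_ne_zero_of_pairing_ne_zero {lam : Fin 3 → Nat.Partition n}
    {ξ₁ : Word a n → ℂ} {ξ₂ : Word b n → ℂ} {ξ₃ : Word c n → ℂ}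
    (h₁ : ξ₁ ∈ highestWeightSpace (wordRep ℂ a n) (Weight.ofPartition a (lam 0)))
    (h₂ : ξ₂ ∈ highestWeightSpace (wordRep ℂ b n) (Weight.ofPartition b (lam 1)))
    (h₃ : ξ₃ ∈ highestWeightSpace (wordRep ℂ c n) (Weight.ofPartition c (lam 2)))
    (A : Matrix (Fin a) (Fin a) ℂ) (B : Matrix (Fin b) (Fin b) ℂ) (C : Matrix (Fin c) (Fin c) ℂ)
    (t : Fin a → Fin b → Fin c → ℂ)
    (h : ∑ u, ∑ v, ∑ w, kroneckerPow (actTensor A B C t) n u v w * triad ξ₁ ξ₂ ξ₃ u v w ≠ 0) :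
    isotypicSum₁ (lam 0) (isotypicSum₂ (lam 1) (isotypicSum₃ (lam 2) (kroneckerPow t n))) ≠ 0 := by
  rw [isotypicSum₁₂₃_ne_zero_iff]
  intro h0
  apply h
  rw [kroneckerPow_actTensor_powMat, sum_actTensor_mul, transpose_powMat, transpose_powMat,
    transpose_powMat, actTensor_triad]
  have e₁ : wordIsotypicMatrix a n (lam 0) *ᵥ (powMat Aᵀ n *ᵥ ξ₁) = powMat Aᵀ n *ᵥ ξ₁ := by
    rw [wordIsotypicMatrix_mulVec_powMat_mulVec, wordIsotypicMatrix_mulVec_of_mem_highestWeightSpace h₁]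
  have e₂ : wordIsotypicMatrix b n (lam 1) *ᵥ (powMat Bᵀ n *ᵥ ξ₂) = powMat Bᵀ n *ᵥ ξ₂ := by
    rw [wordIsotypicMatrix_mulVec_powMat_mulVec, wordIsotypicMatrix_mulVec_of_mem_highestWeightSpace h₂]
  have e₃ : wordIsotypicMatrix c n (lam 2) *ᵥ (powMat Cᵀ n *ᵥ ξ₃) = powMat Cᵀ n *ᵥ ξ₃ := by
    rw [wordIsotypicMatrix_mulVec_powMat_mulVec, wordIsotypicMatrix_mulVec_of_mem_highestWeightSpace h₃]
  have htri : triad (powMat Aᵀ n *ᵥ ξ₁) (powMat Bᵀ n *ᵥ ξ₂) (powMat Cᵀ n *ᵥ ξ₃) =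
      actTensor (wordIsotypicMatrix a n (lam 0)) (wordIsotypicMatrix b n (lam 1))
        (wordIsotypicMatrix c n (lam 2))
        (triad (powMat Aᵀ n *ᵥ ξ₁) (powMat Bᵀ n *ᵥ ξ₂) (powMat Cᵀ n *ᵥ ξ₃)) := by
    rw [actTensor_triad, e₁, e₂, e₃]
  rw [htri, sum_mul_actTensor, transpose_wordIsotypicMatrix, transpose_wordIsotypicMatrix,
    transpose_wordIsotypicMatrix, h0]
  simp

end FromPairing

/-! ## §3 From occurrence to a non-vanishing pairing -/

section ToPairing

variable {a b c n : ℕ}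

/-- **From occurrence to a pairing** (Schur–Weyl duality in span form, tree:
`exists_pairing_triad_ne_zero`): if `λ` occurs in `t^{⊗n}` then some translate of a triad of
highest-weight vectors of weights `λ⁽⁰⁾, λ⁽¹⁾, λ⁽²⁾` pairs non-trivially with it, i.e.
`⟪((A ⊗ B ⊗ C)·t)^{⊗n}, ξ₁ ⊗ ξ₂ ⊗ ξ₃⟫ ≠ 0` for some (invertible) `A, B, C`.
[cite: BurgisserIkenmeyer2011, §3.1 and §10.1] -/
theorem exists_pairing_ne_zero_of_isotypicSum₁₂₃_kroneckerPow_ne_zero {lam : Fin 3 → Nat.Partition n}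
    {t : Fin a → Fin b → Fin c → ℂ}
    (h : isotypicSum₁ (lam 0) (isotypicSum₂ (lam 1) (isotypicSum₃ (lam 2) (kroneckerPow t n))) ≠ 0) :
    ∃ (A : Matrix (Fin a) (Fin a) ℂ) (B : Matrix (Fin b) (Fin b) ℂ) (C : Matrix (Fin c) (Fin c) ℂ)
      (ξ₁ : Word a n → ℂ) (ξ₂ : Word b n → ℂ) (ξ₃ : Word c n → ℂ),
      ξ₁ ∈ highestWeightSpace (wordRep ℂ a n) (Weight.ofPartition a (lam 0)) ∧
      ξ₂ ∈ highestWeightSpace (wordRep ℂ b n) (Weight.ofPartition b (lam 1)) ∧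
      ξ₃ ∈ highestWeightSpace (wordRep ℂ c n) (Weight.ofPartition c (lam 2)) ∧
      ∑ u, ∑ v, ∑ w, kroneckerPow (actTensor A B C t) n u v w * triad ξ₁ ξ₂ ξ₃ u v w ≠ 0 := by
  rw [isotypicSum₁₂₃_ne_zero_iff] at h
  obtain ⟨g₁, g₂, g₃, ξ₁, ξ₂, ξ₃, h₁, h₂, h₃, hne⟩ := exists_pairing_triad_ne_zero h
  rw [pairing_triad_wordRep] at hne
  exact ⟨_, _, _, ξ₁, ξ₂, ξ₃, h₁, h₂, h₃, hne⟩

end ToPairing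

/-! ## §4 A common translate: the pairings are polynomial along lines of matrix triples -/

section Line

variable {a b c : ℕ}

/-- Along an affine line of matrix triples `z ↦ (A₀ + z A₁, B₀ + z B₁, C₀ + z C₁)` the pairing
`⟪((A ⊗ B ⊗ C)·t)^{⊗n}, Ξ⟫` is a polynomial function of `z`. [folklore] -/
theorem exists_polynomial_pairing_line (t : Fin a → Fin b → Fin c → ℂ) (n : ℕ)
    (A₀ A₁ : Matrix (Fin a) (Fin a) ℂ) (B₀ B₁ : Matrix (Fin b) (Fin b) ℂ)
    (C₀ C₁ : Matrix (Fin c) (Fin c) ℂ) (Ξ : Word a n → Word b n → Word c n → ℂ) :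
    ∃ p : Polynomial ℂ, ∀ z : ℂ, p.eval z =
      ∑ u, ∑ v, ∑ w, kroneckerPow (actTensor (A₀ + z • A₁) (B₀ + z • B₁) (C₀ + z • C₁) t) n u v w *
        Ξ u v w := by
  let E : Fin a → Fin b → Fin c → Polynomial ℂ := fun i j k =>
    ∑ i', ∑ j', ∑ k', (Polynomial.C (A₀ i i') + Polynomial.X * Polynomial.C (A₁ i i')) *
      (Polynomial.C (B₀ j j') + Polynomial.X * Polynomial.C (B₁ j j')) *
      (Polynomial.C (C₀ k k') + Polynomial.X * Polynomial.C (C₁ k k')) * Polynomial.C (t i' j' k')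
  have hE : ∀ z i j k, (E i j k).eval z =
      actTensor (A₀ + z • A₁) (B₀ + z • B₁) (C₀ + z • C₁) t i j k := by
    intro z i j k
    simp only [E, Polynomial.eval_finsetSum, Polynomial.eval_mul, Polynomial.eval_add,
      Polynomial.eval_C, Polynomial.eval_X, actTensor_apply, Matrix.add_apply, Matrix.smul_apply,
      smul_eq_mul]
  refine ⟨∑ u, ∑ v, ∑ w, (∏ m, E (u m) (v m) (w m)) * Polynomial.C (Ξ u v w), fun z => ?_⟩
  simp only [Polynomial.eval_finsetSum, Polynomial.eval_mul, Polynomial.eval_prod,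
    Polynomial.eval_C, hE, kroneckerPow_apply]

/-- **A common translate.** If a pairing of degree `n` does not vanish at the matrix triple
`(A₀, B₀, C₀)` and a pairing of degree `m` does not vanish at `(A₁, B₁, C₁)`, then both are
nonzero at a common triple `(A, B, C)` (on the line through the two triples both pairings are
nonzero polynomials in the parameter, with finitely many roots; `ℂ` is infinite). This replaces
the irreducibility of `GL × GL × GL` in the classical argument that occurring types form a
semigroup. [cite: BurgisserIkenmeyer2011, §3.1] -/
theorem exists_common_pairing_ne_zero {t : Fin a → Fin b → Fin c → ℂ} {n m : ℕ}
    {Ξ : Word a n → Word b n → Word c n → ℂ} {Ξ' : Word a m → Word b m → Word c m → ℂ}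
    {A₀ A₁ : Matrix (Fin a) (Fin a) ℂ} {B₀ B₁ : Matrix (Fin b) (Fin b) ℂ}
    {C₀ C₁ : Matrix (Fin c) (Fin c) ℂ}
    (h₀ : ∑ u, ∑ v, ∑ w, kroneckerPow (actTensor A₀ B₀ C₀ t) n u v w * Ξ u v w ≠ 0)
    (h₁ : ∑ u, ∑ v, ∑ w, kroneckerPow (actTensor A₁ B₁ C₁ t) m u v w * Ξ' u v w ≠ 0) :
    ∃ (A : Matrix (Fin a) (Fin a) ℂ) (B : Matrix (Fin b) (Fin b) ℂ) (C : Matrix (Fin c) (Fin c) ℂ),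
      (∑ u, ∑ v, ∑ w, kroneckerPow (actTensor A B C t) n u v w * Ξ u v w) ≠ 0 ∧
      (∑ u, ∑ v, ∑ w, kroneckerPow (actTensor A B C t) m u v w * Ξ' u v w) ≠ 0 := by
  classical
  obtain ⟨p, hp⟩ := exists_polynomial_pairing_line t n A₀ (A₁ - A₀) B₀ (B₁ - B₀) C₀ (C₁ - C₀) Ξ
  obtain ⟨q, hq⟩ := exists_polynomial_pairing_line t m A₀ (A₁ - A₀) B₀ (B₁ - B₀) C₀ (C₁ - C₀) Ξ'
  have hp0 : p ≠ 0 := by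
    intro hp0
    apply h₀
    have h := hp 0
    rw [hp0, Polynomial.eval_zero, zero_smul, zero_smul, zero_smul, add_zero, add_zero, add_zero] at h
    exact h.symm
  have hq0 : q ≠ 0 := by
    intro hq0
    apply h₁
    have h := hq 1
    rw [hq0, Polynomial.eval_zero, one_smul, one_smul, one_smul, add_sub_cancel, add_sub_cancel,
      add_sub_cancel] at h
    exact h.symm
  obtain ⟨z, hz⟩ := Infinite.exists_notMem_finset (p.roots.toFinset ∪ q.roots.toFinset)
  rw [Finset.mem_union, not_or, Multiset.mem_toFinset, Multiset.mem_toFinset,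
    Polynomial.mem_roots hp0, Polynomial.mem_roots hq0, Polynomial.IsRoot.def,
    Polynomial.IsRoot.def] at hz
  refine ⟨A₀ + z • (A₁ - A₀), B₀ + z • (B₁ - B₀), C₀ + z • (C₁ - C₀), ?_, ?_⟩
  · rw [← hp z]; exact hz.1
  · rw [← hq z]; exact hz.2

end Line

/-! ## §5 Pairings multiply under concatenation -/

section Concat

variable {a b c : ℕ}

/-- A sum over words of length `n + m` is a double sum over words of lengths `n` and `m`
(concatenation `Fin.append`). [folklore] -/
theorem sum_word_add {N n m : ℕ} (F : Word N (n + m) → ℂ) :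
    ∑ u, F u = ∑ u₁ : Word N n, ∑ u₂ : Word N m, F (Fin.append u₁ u₂) := by
  rw [← Equiv.sum_comp (Fin.appendEquiv n m), Fintype.sum_prod_type]
  rfl

/-- **Pairings multiply**: `⟪x^{⊗(n+m)}, (ξ₁⊙ξ₁') ⊗ (ξ₂⊙ξ₂') ⊗ (ξ₃⊙ξ₃')⟫ =
⟪x^{⊗n}, ξ₁ ⊗ ξ₂ ⊗ ξ₃⟫ · ⟪x^{⊗m}, ξ₁' ⊗ ξ₂' ⊗ ξ₃'⟫` for the concatenation products `⊙`
(`concatFun`) — the product of two highest-weight covariants evaluated at `x`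
("multiplying highest weight vectors"). [cite: BurgisserIkenmeyer2011, §10.1] -/
theorem pairing_concatFun (x : Fin a → Fin b → Fin c → ℂ) (n m : ℕ)
    (ξ₁ : Word a n → ℂ) (ξ₂ : Word b n → ℂ) (ξ₃ : Word c n → ℂ)
    (ξ₁' : Word a m → ℂ) (ξ₂' : Word b m → ℂ) (ξ₃' : Word c m → ℂ) :
    ∑ u, ∑ v, ∑ w, kroneckerPow x (n + m) u v w *
        triad (concatFun ξ₁ ξ₁') (concatFun ξ₂ ξ₂') (concatFun ξ₃ ξ₃') u v w =
      (∑ u, ∑ v, ∑ w, kroneckerPow x n u v w * triad ξ₁ ξ₂ ξ₃ u v w) *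
        (∑ u, ∑ v, ∑ w, kroneckerPow x m u v w * triad ξ₁' ξ₂' ξ₃' u v w) := by
  have key : ∀ (u₁ : Word a n) (u₂ : Word a m) (v₁ : Word b n) (v₂ : Word b m) (w₁ : Word c n)
      (w₂ : Word c m),
      kroneckerPow x (n + m) (Fin.append u₁ u₂) (Fin.append v₁ v₂) (Fin.append w₁ w₂) *
        triad (concatFun ξ₁ ξ₁') (concatFun ξ₂ ξ₂') (concatFun ξ₃ ξ₃')
          (Fin.append u₁ u₂) (Fin.append v₁ v₂) (Fin.append w₁ w₂) =
      (kroneckerPow x n u₁ v₁ w₁ * triad ξ₁ ξ₂ ξ₃ u₁ v₁ w₁) *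
        (kroneckerPow x m u₂ v₂ w₂ * triad ξ₁' ξ₂' ξ₃' u₂ v₂ w₂) := by
    intros
    simp only [kroneckerPow_apply, triad_apply, concatFun_append, Fin.prod_univ_add,
      Fin.append_left, Fin.append_right]
    ring
  simp_rw [sum_word_add, key]
  simp only [Finset.sum_mul_sum]

end Concat

/-! ## §6 The semigroup property on alphabets `Fin a, Fin b, Fin c` -/

section Semigroup

variable {a b c n m : ℕ}

/-- **The occurring triples of the powers of a tensor form a semigroup** (alphabets `Fin a`,
`Fin b`, `Fin c`; weight form): if `λ = (λ⁽⁰⁾, λ⁽¹⁾, λ⁽²⁾) ⊢ n` occurs in `t^{⊗n}` and `λ' ⊢ m` occurs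
in `t^{⊗m}` (the triple isotypic character sums do not kill the powers), then every triple
`Λ ⊢ n + m` with weights `Λ⁽ʲ⁾ = λ⁽ʲ⁾ + λ'⁽ʲ⁾` (row-wise) occurs in `t^{⊗(n+m)}`. This is the
semigroup half of "`S(w)` is a finitely generated subsemigroup" for Bürgisser–Ikenmeyer's
semigroup of representations of the orbit closure (Def. 3.1), proved as in §10.1 there and in
Christandl–Harrow–Mitchison / Ikenmeyer–Panova ("multiplying highest weight vectors"): translate,
pair with highest-weight vectors (§3), move both pairings to a common translate (§4), multiply (§5),
and read occurrence off the product (§2). [cite: BurgisserIkenmeyer2011, Def. 3.1 and §10.1] -/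
theorem isotypicSum₁₂₃_kroneckerPow_ne_zero_of_ofPartition_add {t : Fin a → Fin b → Fin c → ℂ}
    {lam : Fin 3 → Nat.Partition n} {lam' : Fin 3 → Nat.Partition m}
    {Lam : Fin 3 → Nat.Partition (n + m)}
    (e₀ : Weight.ofPartition a (Lam 0) = Weight.ofPartition a (lam 0) + Weight.ofPartition a (lam' 0))
    (e₁ : Weight.ofPartition b (Lam 1) = Weight.ofPartition b (lam 1) + Weight.ofPartition b (lam' 1))
    (e₂ : Weight.ofPartition c (Lam 2) = Weight.ofPartition c (lam 2) + Weight.ofPartition c (lam' 2))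
    (h : isotypicSum₁ (lam 0) (isotypicSum₂ (lam 1) (isotypicSum₃ (lam 2) (kroneckerPow t n))) ≠ 0)
    (h' : isotypicSum₁ (lam' 0) (isotypicSum₂ (lam' 1) (isotypicSum₃ (lam' 2)
      (kroneckerPow t m))) ≠ 0) :
    isotypicSum₁ (Lam 0) (isotypicSum₂ (Lam 1) (isotypicSum₃ (Lam 2) (kroneckerPow t (n + m)))) ≠ 0 := by
  obtain ⟨A₀, B₀, C₀, ξ₁, ξ₂, ξ₃, h₁, h₂, h₃, hne⟩ :=
    exists_pairing_ne_zero_of_isotypicSum₁₂₃_kroneckerPow_ne_zero h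
  obtain ⟨A₁, B₁, C₁, ξ₁', ξ₂', ξ₃', h₁', h₂', h₃', hne'⟩ :=
    exists_pairing_ne_zero_of_isotypicSum₁₂₃_kroneckerPow_ne_zero h'
  obtain ⟨A, B, C, hA, hA'⟩ := exists_common_pairing_ne_zero hne hne'
  refine isotypicSum₁₂₃_kroneckerPow_ne_zero_of_pairing_ne_zero (lam := Lam)
    (ξ₁ := concatFun ξ₁ ξ₁') (ξ₂ := concatFun ξ₂ ξ₂') (ξ₃ := concatFun ξ₃ ξ₃') ?_ ?_ ?_ A B C t ?_
  · rw [e₀]; exact concatFun_mem_highestWeightSpace h₁ h₁'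
  · rw [e₁]; exact concatFun_mem_highestWeightSpace h₂ h₂'
  · rw [e₂]; exact concatFun_mem_highestWeightSpace h₃ h₃'
  · rw [pairing_concatFun]; exact mul_ne_zero hA hA'

/-- **Semigroup property, row-wise sums** (alphabets `Fin a, Fin b, Fin c`): if `λ` occurs in
`t^{⊗n}` and `λ'` in `t^{⊗m}` then the triple of row-wise sums `λ⁽ʲ⁾ + λ'⁽ʲ⁾`
(`Nat.Partition.rowAdd`) occurs in `t^{⊗(n+m)}`. [cite: BurgisserIkenmeyer2011, Def. 3.1 and §10.1] -/
theorem isotypicSum₁₂₃_kroneckerPow_ne_zero_rowAdd_fin {t : Fin a → Fin b → Fin c → ℂ}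
    {lam : Fin 3 → Nat.Partition n} {lam' : Fin 3 → Nat.Partition m}
    (h : isotypicSum₁ (lam 0) (isotypicSum₂ (lam 1) (isotypicSum₃ (lam 2) (kroneckerPow t n))) ≠ 0)
    (h' : isotypicSum₁ (lam' 0) (isotypicSum₂ (lam' 1) (isotypicSum₃ (lam' 2)
      (kroneckerPow t m))) ≠ 0) :
    isotypicSum₁ ((lam 0).rowAdd (lam' 0)) (isotypicSum₂ ((lam 1).rowAdd (lam' 1))
      (isotypicSum₃ ((lam 2).rowAdd (lam' 2)) (kroneckerPow t (n + m)))) ≠ 0 :=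
  isotypicSum₁₂₃_kroneckerPow_ne_zero_of_ofPartition_add (Lam := fun j => (lam j).rowAdd (lam' j))
    (Literature.Computability.Complexity.ofPartition_rowAdd a _ _)
    (Literature.Computability.Complexity.ofPartition_rowAdd b _ _)
    (Literature.Computability.Complexity.ofPartition_rowAdd c _ _) h h'

/-- The partition `kλ` with parts `k λᵢ` (`k ≥ 1`). [folklore] -/
theorem exists_partition_parts_eq_map_mul (lam : Nat.Partition n) {k : ℕ} (hk : 0 < k) :
    ∃ mu : Nat.Partition (k * n), mu.parts = lam.parts.map (k * ·) := by
  refine ⟨⟨lam.parts.map (k * ·), @fun i hi => ?_, ?_⟩, rfl⟩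
  · obtain ⟨p, hp, rfl⟩ := Multiset.mem_map.1 hi
    exact Nat.mul_pos hk (lam.parts_pos hp)
  · rw [Multiset.sum_map_mul_left, Multiset.map_id', lam.parts_sum]

/-- **Scaling** (alphabets `Fin a, Fin b, Fin c`): if `λ` occurs in `t^{⊗n}` then for every
`k ≥ 1` the scaled triple `kλ` (parts multiplied by `k`) occurs in `t^{⊗kn}` — iterate the
semigroup property. Hence the normalised occurring triples `λ/n` only depend on the ray of `λ`,
as in the passage from `S(w)` to the moment polytope (BI 2011 Lemma 10.18–10.19).
[cite: BurgisserIkenmeyer2011, Def. 3.1, §10.1 and Lemma 10.19] -/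
theorem isotypicSum₁₂₃_kroneckerPow_ne_zero_of_parts_eq_map_mul {t : Fin a → Fin b → Fin c → ℂ}
    {lam : Fin 3 → Nat.Partition n}
    (h : isotypicSum₁ (lam 0) (isotypicSum₂ (lam 1) (isotypicSum₃ (lam 2) (kroneckerPow t n))) ≠ 0)
    {k : ℕ} (hk : 0 < k) {M : ℕ} (hM : M = k * n) {mu : Fin 3 → Nat.Partition M}
    (hmu : ∀ j, (mu j).parts = (lam j).parts.map (k * ·)) :
    isotypicSum₁ (mu 0) (isotypicSum₂ (mu 1) (isotypicSum₃ (mu 2) (kroneckerPow t M))) ≠ 0 := by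
  obtain ⟨k, rfl⟩ : ∃ j, k = j + 1 := ⟨k - 1, (Nat.succ_pred_eq_of_pos hk).symm⟩
  clear hk
  induction k generalizing M mu with
  | zero =>
    rw [zero_add, one_mul] at hM
    subst hM
    have hml : mu = lam := by
      funext j
      refine Nat.Partition.ext ?_
      rw [hmu j]
      simp
    rw [hml]
    exact h
  | succ k ih =>
    choose mu' hmu' using fun j => exists_partition_parts_eq_map_mul (lam j) (Nat.succ_pos k)
    have ih' := ih rfl hmu'
    rw [add_one_mul] at hM
    subst hM
    refine isotypicSum₁₂₃_kroneckerPow_ne_zero_of_ofPartition_add (lam := mu') (lam' := lam)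
      (Lam := mu) ?_ ?_ ?_ ih' h
    · rw [ofPartition_eq_smul_of_parts_eq a (hmu 0), ofPartition_eq_smul_of_parts_eq a (hmu' 0),
        succ_nsmul]
    · rw [ofPartition_eq_smul_of_parts_eq b (hmu 1), ofPartition_eq_smul_of_parts_eq b (hmu' 1),
        succ_nsmul]
    · rw [ofPartition_eq_smul_of_parts_eq c (hmu 2), ofPartition_eq_smul_of_parts_eq c (hmu' 2),
        succ_nsmul]

end Semigroup

/-! ## §7 Arbitrary finite index types (relabelling letters) -/

section General

variable {ι κ μ : Type} [Fintype ι] [Fintype κ] [Fintype μ] {n m : ℕ}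

/-- Relabelling the letters of the three alphabets along bijections does not change occurrence
(both tensors restrict to each other by permutation matrices; occurrence is monotone under
restriction, `isotypicSum₁₂₃_kroneckerPow_ne_zero_of_restrictsTo`). [folklore] -/
theorem isotypicSum₁₂₃_kroneckerPow_ne_zero_relabel_iff (t : ι → κ → μ → ℂ)
    (e₁ : ι ≃ Fin (Fintype.card ι)) (e₂ : κ ≃ Fin (Fintype.card κ)) (e₃ : μ ≃ Fin (Fintype.card μ))
    (lam : Fin 3 → Nat.Partition n) :
    isotypicSum₁ (lam 0) (isotypicSum₂ (lam 1) (isotypicSum₃ (lam 2)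
        (kroneckerPow (fun i j k => t (e₁.symm i) (e₂.symm j) (e₃.symm k)) n))) ≠ 0 ↔
      isotypicSum₁ (lam 0) (isotypicSum₂ (lam 1) (isotypicSum₃ (lam 2) (kroneckerPow t n))) ≠ 0 := by
  classical
  have hst : TensorRestrictsTo t (fun i j k => t (e₁.symm i) (e₂.symm j) (e₃.symm k)) :=
    tensorRestrictsTo_precomp t e₁.symm e₂.symm e₃.symm
  have hts : TensorRestrictsTo (fun i j k => t (e₁.symm i) (e₂.symm j) (e₃.symm k)) t := by
    have e : t = fun i j k => (fun i j k => t (e₁.symm i) (e₂.symm j) (e₃.symm k))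
        (e₁ i) (e₂ j) (e₃ k) := by
      funext i j k; simp
    conv_rhs => rw [e]
    exact tensorRestrictsTo_precomp _ e₁ e₂ e₃
  exact ⟨fun h => isotypicSum₁₂₃_kroneckerPow_ne_zero_of_restrictsTo hst h,
    fun h => isotypicSum₁₂₃_kroneckerPow_ne_zero_of_restrictsTo hts h⟩

/-- **The semigroup of occurring triples, arbitrary finite index types, weight form**: if `λ ⊢ n`
occurs in `t^{⊗n}` and `λ' ⊢ m` in `t^{⊗m}` then every `Λ ⊢ n + m` whose `GL`-weights (for the
alphabet sizes `|ι|, |κ|, |μ|`) are the sums `λ⁽ʲ⁾ + λ'⁽ʲ⁾` occurs in `t^{⊗(n+m)}`.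
[cite: BurgisserIkenmeyer2011, Def. 3.1 and §10.1] -/
theorem isotypicSum₁₂₃_kroneckerPow_ne_zero_of_ofPartition_add' {t : ι → κ → μ → ℂ}
    {lam : Fin 3 → Nat.Partition n} {lam' : Fin 3 → Nat.Partition m}
    {Lam : Fin 3 → Nat.Partition (n + m)}
    (e₀ : Weight.ofPartition (Fintype.card ι) (Lam 0) =
      Weight.ofPartition (Fintype.card ι) (lam 0) + Weight.ofPartition (Fintype.card ι) (lam' 0))
    (e₁ : Weight.ofPartition (Fintype.card κ) (Lam 1) =
      Weight.ofPartition (Fintype.card κ) (lam 1) + Weight.ofPartition (Fintype.card κ) (lam' 1))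
    (e₂ : Weight.ofPartition (Fintype.card μ) (Lam 2) =
      Weight.ofPartition (Fintype.card μ) (lam 2) + Weight.ofPartition (Fintype.card μ) (lam' 2))
    (h : isotypicSum₁ (lam 0) (isotypicSum₂ (lam 1) (isotypicSum₃ (lam 2) (kroneckerPow t n))) ≠ 0)
    (h' : isotypicSum₁ (lam' 0) (isotypicSum₂ (lam' 1) (isotypicSum₃ (lam' 2)
      (kroneckerPow t m))) ≠ 0) :
    isotypicSum₁ (Lam 0) (isotypicSum₂ (Lam 1) (isotypicSum₃ (Lam 2) (kroneckerPow t (n + m)))) ≠ 0 := by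
  classical
  rw [← isotypicSum₁₂₃_kroneckerPow_ne_zero_relabel_iff t (Fintype.equivFin ι) (Fintype.equivFin κ)
    (Fintype.equivFin μ)] at h h' ⊢
  exact isotypicSum₁₂₃_kroneckerPow_ne_zero_of_ofPartition_add e₀ e₁ e₂ h h'

/-- **`S(t)` is a semigroup** (Bürgisser–Ikenmeyer's semigroup of representations of the orbit
closure of a tensor `t ∈ ℂ^ι ⊗ ℂ^κ ⊗ ℂ^μ`, Def. 3.1, in the coordinates of
`QuantumFunctionalsUpper.lean`): if the triple `λ ⊢ n` occurs in `t^{⊗n}` and `λ' ⊢ m` occurs in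
`t^{⊗m}` (the triple isotypic character sums do not kill the powers), then the triple of row-wise
sums `λ⁽ʲ⁾ + λ'⁽ʲ⁾` (`Nat.Partition.rowAdd`) occurs in `t^{⊗(n+m)}` ("It is known that `S(w)` is
a finitely generated subsemigroup"; the finite generation is not treated here).
[cite: BurgisserIkenmeyer2011, Def. 3.1 and §10.1] -/
theorem isotypicSum₁₂₃_kroneckerPow_ne_zero_rowAdd {t : ι → κ → μ → ℂ}
    {lam : Fin 3 → Nat.Partition n} {lam' : Fin 3 → Nat.Partition m}
    (h : isotypicSum₁ (lam 0) (isotypicSum₂ (lam 1) (isotypicSum₃ (lam 2) (kroneckerPow t n))) ≠ 0)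
    (h' : isotypicSum₁ (lam' 0) (isotypicSum₂ (lam' 1) (isotypicSum₃ (lam' 2)
      (kroneckerPow t m))) ≠ 0) :
    isotypicSum₁ ((lam 0).rowAdd (lam' 0)) (isotypicSum₂ ((lam 1).rowAdd (lam' 1))
      (isotypicSum₃ ((lam 2).rowAdd (lam' 2)) (kroneckerPow t (n + m)))) ≠ 0 :=
  isotypicSum₁₂₃_kroneckerPow_ne_zero_of_ofPartition_add' (Lam := fun j => (lam j).rowAdd (lam' j))
    (Literature.Computability.Complexity.ofPartition_rowAdd _ _ _)
    (Literature.Computability.Complexity.ofPartition_rowAdd _ _ _)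
    (Literature.Computability.Complexity.ofPartition_rowAdd _ _ _) h h'

/-- **Scaling of occurring triples** (arbitrary finite index types): if `λ` occurs in `t^{⊗n}`
then every `kλ` (`k ≥ 1`, parts multiplied by `k`) occurs in `t^{⊗kn}`.
[cite: BurgisserIkenmeyer2011, Def. 3.1, §10.1 and Lemma 10.19] -/
theorem isotypicSum₁₂₃_kroneckerPow_ne_zero_of_parts_eq_map_mul' {t : ι → κ → μ → ℂ}
    {lam : Fin 3 → Nat.Partition n}
    (h : isotypicSum₁ (lam 0) (isotypicSum₂ (lam 1) (isotypicSum₃ (lam 2) (kroneckerPow t n))) ≠ 0)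
    {k : ℕ} (hk : 0 < k) {M : ℕ} (hM : M = k * n) {mu : Fin 3 → Nat.Partition M}
    (hmu : ∀ j, (mu j).parts = (lam j).parts.map (k * ·)) :
    isotypicSum₁ (mu 0) (isotypicSum₂ (mu 1) (isotypicSum₃ (mu 2) (kroneckerPow t M))) ≠ 0 := by
  classical
  rw [← isotypicSum₁₂₃_kroneckerPow_ne_zero_relabel_iff t (Fintype.equivFin ι) (Fintype.equivFin κ)
    (Fintype.equivFin μ)] at h ⊢
  exact isotypicSum₁₂₃_kroneckerPow_ne_zero_of_parts_eq_map_mul h hk hM hmu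

/-- **Scaled occurrence, in the shape of `vandenBergEtAl2025_unitTensor_four_polytope_maximal`**:
if `λ` occurs in `t^{⊗n}` then for every `k ≥ 1` there is the scaled triple `μ = kλ ⊢ kn`
(`μ⁽ʲ⁾.parts = λ⁽ʲ⁾.parts.map (k * ·)`) and it occurs in `t^{⊗kn}`. In particular the conclusion of
that named fact, once known for ONE multiple `kλ`, holds for all multiples of `k`.
[cite: BurgisserIkenmeyer2011, Def. 3.1, §10.1 and Lemma 10.19] -/
theorem exists_isotypicSum₁₂₃_kroneckerPow_mul_ne_zero {t : ι → κ → μ → ℂ}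
    {lam : Fin 3 → Nat.Partition n}
    (h : isotypicSum₁ (lam 0) (isotypicSum₂ (lam 1) (isotypicSum₃ (lam 2) (kroneckerPow t n))) ≠ 0)
    {k : ℕ} (hk : 0 < k) :
    ∃ mu : Fin 3 → Nat.Partition (k * n), (∀ j, (mu j).parts = (lam j).parts.map (fun p => k * p)) ∧
      isotypicSum₁ (mu 0) (isotypicSum₂ (mu 1) (isotypicSum₃ (mu 2) (kroneckerPow t (k * n)))) ≠ 0 := by
  choose mu hmu using fun j => exists_partition_parts_eq_map_mul (lam j) hk
  exact ⟨mu, hmu, isotypicSum₁₂₃_kroneckerPow_ne_zero_of_parts_eq_map_mul' h hk rfl hmu⟩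

end General

/-! ## §8 Occurrence up to scaling is closed under row-wise sums (the glue behind "some multiple occurs") -/

section Saturation

variable {ι κ μ : Type} [Fintype ι] [Fintype κ] [Fintype μ] {n m : ℕ}

/-- **"Some multiple occurs" is closed under row-wise sums.** Write `M(t)` for the set of triples
`λ ⊢ n` some multiple `kλ ⊢ kn` (`k ≥ 1`, parts multiplied by `k`) of which occurs in `t^{⊗kn}` —
the shape of the conclusion of `vandenBergEtAl2025_unitTensor_four_polytope_maximal` (there
`t = ⟨4⟩`); normalised, `M(t)` is the set of rational points `λ/n` of the moment polytope `Δ(t)`.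
If `λ ∈ M(t)` and `λ' ∈ M(t)` then the row-wise sum `λ + λ' ∈ M(t)`: with `kλ` and `k'λ'` occurring,
`k'(kλ)` and `k(k'λ')` occur (scaling) and so does their sum `kk'(λ + λ')` (semigroup). Hence, once
the conclusion of that named fact is known for a family of triples, it holds for the whole
semigroup they generate under row-wise sums (BI 2011, Lemma 10.18–10.19: it suffices to hit
generators). [cite: BurgisserIkenmeyer2011, Def. 3.1, §10.1 and Lemma 10.18–10.19] -/
theorem exists_mul_rowAdd_isotypicSum₁₂₃_kroneckerPow_ne_zero {t : ι → κ → μ → ℂ}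
    {lam : Fin 3 → Nat.Partition n} {lam' : Fin 3 → Nat.Partition m}
    (h : ∃ (k : ℕ) (mu : Fin 3 → Nat.Partition (k * n)), 0 < k ∧
      (∀ j, (mu j).parts = (lam j).parts.map (fun p => k * p)) ∧
        isotypicSum₁ (mu 0) (isotypicSum₂ (mu 1) (isotypicSum₃ (mu 2) (kroneckerPow t (k * n)))) ≠ 0)
    (h' : ∃ (k : ℕ) (mu : Fin 3 → Nat.Partition (k * m)), 0 < k ∧
      (∀ j, (mu j).parts = (lam' j).parts.map (fun p => k * p)) ∧
        isotypicSum₁ (mu 0) (isotypicSum₂ (mu 1) (isotypicSum₃ (mu 2) (kroneckerPow t (k * m)))) ≠ 0) :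
    ∃ (k : ℕ) (rho : Fin 3 → Nat.Partition (k * (n + m))), 0 < k ∧
      (∀ j, (rho j).parts = ((lam j).rowAdd (lam' j)).parts.map (fun p => k * p)) ∧
        isotypicSum₁ (rho 0) (isotypicSum₂ (rho 1) (isotypicSum₃ (rho 2)
          (kroneckerPow t (k * (n + m))))) ≠ 0 := by
  obtain ⟨k, mu, hk, hmu, hocc⟩ := h
  obtain ⟨k', mu', hk', hmu', hocc'⟩ := h'
  -- scale `kλ` by `k'` and `k'λ'` by `k`
  obtain ⟨nu, hnu, hoccnu⟩ := exists_isotypicSum₁₂₃_kroneckerPow_mul_ne_zero hocc hk'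
  obtain ⟨nu', hnu', hoccnu'⟩ := exists_isotypicSum₁₂₃_kroneckerPow_mul_ne_zero hocc' hk
  -- the target triple `kk'(λ + λ')`
  have hK : 0 < k * k' := Nat.mul_pos hk hk'
  choose rho hrho using fun j => exists_partition_parts_eq_map_mul ((lam j).rowAdd (lam' j)) hK
  refine ⟨k * k', rho, hK, hrho, ?_⟩
  -- weights: `ofPartition (rho j) = ofPartition (nu j) + ofPartition (nu' j)`
  have hw : ∀ (N : ℕ) (j : Fin 3), Weight.ofPartition N (rho j) =
      Weight.ofPartition N (nu j) + Weight.ofPartition N (nu' j) := by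
    intro N j
    rw [ofPartition_eq_smul_of_parts_eq N (hrho j), ofPartition_eq_smul_of_parts_eq N (hnu j),
      ofPartition_eq_smul_of_parts_eq N (hnu' j), ofPartition_eq_smul_of_parts_eq N (hmu j),
      ofPartition_eq_smul_of_parts_eq N (hmu' j), Literature.Computability.Complexity.ofPartition_rowAdd,
      smul_add, smul_smul, smul_smul, mul_comm k' k]
  -- transport the semigroup property along `k'(kn) + k(k'm) = kk'(n + m)`
  have key : ∀ (N : ℕ) (e : N = k' * (k * n) + k * (k' * m)) (rho : Fin 3 → Nat.Partition N),
      (∀ (M : ℕ) (j : Fin 3), Weight.ofPartition M (rho j) =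
        Weight.ofPartition M (nu j) + Weight.ofPartition M (nu' j)) →
      isotypicSum₁ (rho 0) (isotypicSum₂ (rho 1) (isotypicSum₃ (rho 2) (kroneckerPow t N))) ≠ 0 := by
    rintro N rfl rho hrho
    exact isotypicSum₁₂₃_kroneckerPow_ne_zero_of_ofPartition_add' (hrho _ 0) (hrho _ 1) (hrho _ 2)
      hoccnu hoccnu'
  exact key (k * k' * (n + m)) (by ring) rho hw

end Saturation

end Literature.Computability.AlgebraicComplexity
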